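import Mathlib
import HarnessLib
import HarnessLib.Audit
import Literature.InformationTheory.QuantumCodes.BivariateBicycleCodes
import Summits.Ventures.QEC.Census.BB.Claims

/-!
Route: BB108DistanceCertificate

CLOSED (proved) 2026-08-27T01:36:33Z by operator:999:1278228 — reason: proved:Summit.Ventures.QEC.Census.BB108.BB108_8_10_claim_holds. The file is kept as the record of this route; refuted decls are indexed as negative knowledge (`ledger negatives`).

# Route BB108DistanceCertificate — the [[108,8,10]] bivariate-bicycle code has distance exactly 10,
by certificate

It suffices to show X = (no Z-type logical operator of the bivariate-bicycle code QC(x³+y+y²,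
y³+x+x²) on ℤ₉ × ℤ₆ = `BB.bb108` has
Hamming weight ≤ 9) ∧ (some Z-type logical operator has weight exactly 10) ∧ (k = n − rk H^X − rk
H^Z = 8). X is the content of a
DISTANCE CERTIFICATE for the printed row [[108,8,10]] of Bravyi–Cross–Gambetta–Maslov–Rall–Yoder
(Nature 627 (2024) Table 1; distance
there "computed by the mixed integer programming approach", no certificate in print): lower bound =
an exhaustive enumeration / UNSAT
certificate re-checked in the kernel, upper bound = one explicit codeword, dimension = a rank
certificate. The route is the LADDER-QEC
rung-Q2 route of cell pub/qec (venture ruling D-0059/D-0061/D-0092): its deciding theorem concludes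
the registered CLAIM leaf
`Summit.Ventures.QEC.BB.BB108_8_10_claim` (`HasParams BB.bb108 108 8 10`), never a summit Statement
(Ventures/QEC has none). No idea card.
Lean: `(∀ v : Literature.InformationTheory.QuantumCodes.BB.Mono 9 6 ⊕
Literature.InformationTheory.QuantumCodes.BB.Mono 9 6 → ZMod 2, Matrix.mulVec
(Literature.InformationTheory.QuantumCodes.BB.bb108).css.HX v = 0 → v ∉
(Literature.InformationTheory.QuantumCodes.BB.bb108).css.rowSpZ → 10 ≤ hammingNorm v) ∧ (∃ v :
Literature.InformationTheory.QuantumCodes.BB.Mono 9 6 ⊕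
Literature.InformationTheory.QuantumCodes.BB.Mono 9 6 → ZMod 2, Matrix.mulVec
(Literature.InformationTheory.QuantumCodes.BB.bb108).css.HX v = 0 ∧ v ∉
(Literature.InformationTheory.QuantumCodes.BB.bb108).css.rowSpZ ∧ hammingNorm v = 10) ∧
(Literature.InformationTheory.QuantumCodes.BB.bb108).k = 8`

## Assembly
Pure logic over three tree lemmas: from `WeightTenZLogical108` take v; `CSSCode.dZ_eq_of_witness hv
hv' hwt NoZLogicalBelowTen108 : BB.bb108.css.dZ = 10`;
`Summit.Ventures.QEC.BB.numQubits_claims.2.2.1 : BB.numQubits 9 6 = 108` (counting, proved);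
`EightLogicalQubits108 : BB.bb108.k = 8`; then
`Summit.Ventures.QEC.BB.hasParams_of_dZ` (d = d^Z, Lemma 1, proved) gives `HasParams BB.bb108 108 8
10 = BB108_8_10_claim`. The deciding theorem
`closes` in glue.lean is exactly this, routed through `Assembly` and `Target` so both are in its
cone (lean check rc 0, 0 sorries).

CLOSES_TARGET: closes rung Q2 of Ventures/QEC: Summit.Ventures.QEC.BB.BB108_8_10_claim (D-0061; not the summit Statement) — the deciding theorem of this route concludes that registered leaf (Ventures/QEC: no summit Statement) (class rung: servable and labelled, never counted as concluding the summit Statement).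

Rationale: WHY THIS LINE. The mechanism is the certificate shape of `CSSCode.dZ_eq_of_witness` (tree,
CSS.lean): an explicit logical of weight d plus the universally
checked statement "every logical has weight ≥ d" give d^Z = d, and for every QC(A, B) d = d^Z = d^X
(Lemma 1 of [BravyiEtAl2024],
arXiv:2308.07915 §4, proved in the tree as `BB.Code.d_eq_dZ`), so one side suffices (cell CERT-REQS
C8). The lower bound is the only
expensive conjunct: it is discharged by certificates the cell already holds and a referee has
ROW-SIGNED (certA = search-1 Brouwer–Zimmermann-with-automorphisms enumeration (bz)
sha16 db2184d2897de525; certB = search-2 CNF→CaDiCaL→LRAT sha16 596bc5aa9a750488, lemma-free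
encoding enc-v1; ref-1
ROW-SIGNED 2026-08-26T18:10:21Z, assumes=none), replayed in Lean by type-10's checker
`Summits/Ventures/QEC/Census/CertCheck.lean`
(`checkDistCert` + soundness, p461106) on the flat matrices `BB.bb108.HXFlat/HZFlat` and transported
to `BB.bb108.css` by the landed bridge
`BB.Code.dZ_eq_of_flat` / `cssFlat_dZ` / `cssFlat_k`. Imported from coding theory:
Brouwer–Zimmermann / information-set enumeration
(search-7's information-set variant) and DRAT/LRAT proof logging for the UNSAT side. What the line
does that print does not: Nature ED Table 1 reports a MIP optimum with no checkable artefact. State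
of the art in Lean (director-qec rulings 2026-08-26T22:04:58Z / 22:52:31Z R2(3)): Lean-QEC
(arXiv:2605.16523 v1; repo VerifiedQC/Lean-QEC main @ e0b90148) STATES BB108 with sorry ×4 and the
bv_decide call commented out (lean_prior «stated:sorry») ⇒ a KERNEL-std proof of [[108,8,10]] is a
FIRST COMPLETE LEAN PROOF CANDIDATE — the wording is released only through the cell's lit-3
PRIOR-ART-LeanQEC.md table with file shas, and only at the tier that actually lands. Lean path of
record for the lower bound: kernel-A bz_aut certificate a65ab6ec4f28a92d (2.2e6 visits/side, 6
blocks ⇒ ≈ 1–6 min decide +kernel per block file, search-10 g2 through type-10's CertCheckBZAut) —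
KERNEL-std is FEASIBLE here, unlike 144.

RANKED CRUXES. #0 Target (target) — the printed row — QC(x³+y+y², y³+x+x²) on ℤ₉ × ℤ₆ has parameters
[[108, 8, 10]] (n = 108 data qubits, k = 8, distance EXACTLY 10). (why it might fail: only if the
printed MIP distance or dimension is wrong — four independent cell kernels (bruteforce, CNF/LRAT,
Brouwer–Zimmermann, matrix-method) agree on 8 and 10.) [BravyiEtAl2024, arXiv:2308.07915]
#2 NoZLogicalBelowTen108 (crux) — LOWER BOUND — every v with H^X v = 0 and v ∉ rowspace(H^Z) (a
Z-type logical operator of BB.bb108) has Hamming weight ≥ 10; equivalently no Z-logical of weight ≤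
9 exists. Discharged by a kernel-replayed enumeration / UNSAT certificate (certA bz
db2184d2897de525, certB LRAT 596bc5aa9a750488, or search-7's information-set certificate), via
`CertCheck` soundness + `BB.Code.dZ_eq_of_flat`. [difficulty: M] (why it might fail: false iff a
Z-logical of weight ≤ 9 exists (printed d by MIP, uncertified); residual risk after two signed
certificates = an index-convention slip between the checker's flat literal and `BB.bb108` (x = S_ℓ ⊗
I_m vs I ⊗ S).) [BravyiEtAl2024, arXiv:2308.07915, Vardy1997, KapshikarKundu2023]
#3 WeightTenZLogical108 (crux) — UPPER WITNESS — there is an explicit v with H^X v = 0, v ∉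
rowspace(H^Z) and |v| = 10 (a weight-10 Z-type logical operator); the certificates list one (certA
`upper.Z.word`), non-membership in rowspace(H^Z) is a rank / syndrome check decidable on the literal
matrices. [difficulty: S] (why it might fail: false iff d ≥ 11 (every weight-10 kernel word of H^X
is a Z-stabiliser); the listed witness could be mis-transcribed or secretly in rowspace(H^Z) — the
non-membership proof is the delicate part in Lean.) [BravyiEtAl2024, arXiv:2308.07915]
#9 EightLogicalQubits108 (support) — DIMENSION — k(BB.bb108) = 108 − rk H^X − rk H^Z = 8 (rk H^X =
rk H^Z = 50 over 𝔽₂), by a rank certificate (type-02's Census/RankCert.lean p462257) transported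
with `BB.Code.cssFlat_k`; equivalently k = 2·dim(ker A ∩ ker B) (Lemma 1). [difficulty:
provable-now] [BravyiEtAl2024, arXiv:2308.07915, CalderbankShor1996]

TWO-LAYER PLAN. Foreseen split of NoZLogicalBelowTen108 only if the monolithic kernel replay is too
heavy: NoZLogicalBelowTen108 ⇐ (checker soundness: `checkDistCert cert = true → ∀ v, …` on the flat
code, type-10 CertCheck) → (the data fact `checkDistCert cert = true`, by `decide +kernel` in ≤
400-line chunk files, search-7 emitter; or the information-set variant, one light file per side) →
NoZLogicalBelowTen108 via `BB.Code.dZ_eq_of_flat`; k ≤ 3 children, depth 1. Nothing filed now.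

KILL CRITERIA. A kernel-checked Z-logical (or X-logical, d^X = d^Z) of weight ≤ 9 refutes
NoZLogicalBelowTen108 and the CLAIM itself (route closes refuted:NoZLogicalBelowTen108 and the
census row becomes a DISCREPANCY finding against Nature 627 Table 1); a proof that rk H^X ≠ 50
refutes EightLogicalQubits108 likewise (k = 8: rk H^X = rk H^Z = 50; Census.bb108_k p467715 already
proves k = 8, so this item closes by a 3-line file). A proof of `BB108_8_10_claim` landed by any
other cell file (e.g. search-7's CertNative/Kernel files + Distance.lean discharging the claim
directly) moots the route — it is then closed superseded with the discharging theorem named.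

NOT DECOMPOSED YET. The checker-soundness / data-fact split of the lower bound (Two-layer plan), the
X-side mirror statements (unnecessary: d^X = d^Z is a tree theorem), and the per-chunk leaf theorems
of the kernel replay — all are prover-side packaging below item level (attached with --supports
NoZLogicalBelowTen108), never items.

CHEAPEST FALSIFIER. Run any distance tool on the H^X = [A|B], H^Z = [Bᵀ|Aᵀ] matrices of BB.bb108 and
look for a logical of weight ≤ 9. Done inside the cell before filing: Σ_{w≤9} C(108,w) supports per
side is out of bruteforce range; certA used Brouwer–Zimmermann with the translation automorphism
group (orbit lemma p461461), certB a CNF whose UNSAT proof is LRAT-checked (ref-1 own re-solve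
j256539); ref-1 replayed/re-derived both certificates and ROW-SIGNED (2026-08-26T18:10:21Z,
assumes=none).

NUMBERS. n = 108 = 2·9·6; k = 8; d = d^X = d^Z = 10 (Nature 627 Table 1); rk H^X = rk H^Z = 50;
kernel path of record for d = 10 = the kernel-B leaf chain (search-2 cubes → search-10 leaf files →
type-11 LRATBridge; mitm is infeasible at d = 10, search-9) or the bz-in-Lean checker 10.L5 (type-10
+ type-07 BrouwerZimmermannBound + search-7 CertInfoSet).

DEFINITION REQUESTS. None: `BB.Code`, `BB.bb108`, `CSSCode.dZ/dX/k/rowSpZ`, `hammingNorm`,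
`HasParams`, the flat bridge `BB.Code.cssFlat` (+ `dZ_eq_of_flat`, `cssFlat_k`) and the checker
`Census/CertCheck.lean` are all in the tree. Cite fact wanted: none (BravyiEtAl2024 is in
references.bib; the claim decl carries the locators).

Novelty: Searches (2026-08-26): lit search "bivariate bicycle code distance" (6 local docs: arXiv:2308.07915,
2502.20189, 2510.06495, 2411.03302, 2605.14173, 2503.22071; 13 remote merged, OpenAlex/S2
rate-limited); lit galaxy search "bivariate bicycle|[[108,8,10]]|BB code distance" --star all
(panama 0, pdf 5 decoder papers, crabby 0); cell literature seats lit-3 (LIT-3-CONSTRUCTIONS.md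
v1.1: "how d was established in print" = MILP for all five BB rows, Nature ED Table 1 caption p0011)
and lit-1 (LIT-1-REGISTER.md: families with proved d vs exhaustive/LP vs upper-bound-only).
Nearest prior art found: BravyiEtAl2024 = arXiv:2308.07915 (Nature 627, 778) Table 1 / ED Table 1 —
the parameters by mixed-integer programming (their ref. 68), no certificate; arXiv:2502.20189 Table
I reprints the row; QDistRnd-style randomized upper bounds (Pryadko et al.) for related two-block
codes (lit-3 A2/A3).
Delta: a COMPLETE kernel certificate that QC(x³+y+y², y³+x+x²) on ℤ₉ × ℤ₆ (`BB.bb108`) has distance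
exactly 10 and k = 8 — lower bound (target tier KERNEL-std via bz_aut a65ab6ec4f28a92d; cell rows
certA db2184d2897de525 ∧ certB 596bc5aa9a750488, ref-1 signed) + weight-10 witness + k, two
independent certificate kernels with referee signatures; print has solver (MIP) output only. PRIOR
ART OF RECORD (director-qec 22:04:58Z; FINDINGS PA-1/PA-2): Lean-QEC proves BB72/BB90 completely
(KERNEL-bv) and STATES BB108 with sorry ×4, bv_decide commented out ⇒ «first complete Lean proof»
CANDIDATE, cite their f  [refs: 2308.07915, 2502.20189, BravyiEtAl2024]

Barriers (technique_class: certified-computation, enumeration, unsat-cert): - technique_class: certified-computation, enumeration, unsat-cert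
- Literature.Barriers.Ventures: no catalogued barrier directory exists for Ventures (ls
lean/Literature/Barriers/ has none); the technique-class barrier is NP-hardness of minimum distance
—
`Literature.InformationTheory.QuantumCodes.MinimumDistanceHardness.Vardy1997_minimumDistance_isNPComplete`
and `KapshikarKundu2023_quantumMinimumDistance_isNPHard` (tree, named facts): they bound the
asymptotic cost of a uniform algorithm, not a fixed instance — n = 108, w ≤ 9 is a fixed finite
instance, enumerated with symmetry reduction / UNSAT-certified and kernel-replayed; the route does
not claim a method that scales.
- Negatives index: empty for Ventures/QEC at filing (ledger negatives --problem Ventures consulted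
by the cell's refuter seats; no refuted statement about BB codes).

History (route lifecycle, newest last):
- 2026-08-27T01:36:34Z · CLOSED proved — proved:Summit.Ventures.QEC.Census.BB108.BB108_8_10_claim_holds (operator:999:1278228)

sub-problem: QEC · status: closed(proved) · opened operator:999:2379292 2026-08-26T23:35:05Z · rev 0 · ledger route-Ventures-BB108DistanceCertificate
GENERATED by the gate from the ledger (D-0016/17). Provers cite these decls: `theorem foo : Summit.Ventures.QEC.Theses.BB108DistanceCertificate.<Decl> := …` in Summits/Ventures/QEC/Theorems/<Name>.lean.
-/

namespace Summit.Ventures.QEC.Theses.BB108DistanceCertificate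

open scoped BigOperators Topology Manifold Classical MeasureTheory ProbabilityTheory Matrix InnerProductSpace ComplexConjugate ContinuousMap
open Filter Set Function TopologicalSpace MeasureTheory

-- H21.Audit: Ventures rung route — no summit Statement decl; the expected conclusion is the closer leaf tagged below
attribute [summit_statement] _root_.Summit.Ventures.QEC.BB.BB108_8_10_claim

/-- item stmt-Ventures-19827 · target · rank 0 · closed · proved by Summit.Ventures.QEC.Census.BB108.target108_proof (prover) · by operator
why it might fail: only if the printed MIP distance or dimension is wrong — four independent cell kernels (bruteforce, CNF/LRAT, Brouwer–Zimmermann, matrix-method) agree on 8 and 10.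
sources: BravyiEtAl2024, arXiv:2308.07915
[target] the printed row — QC(x³+y+y², y³+x+x²) on ℤ₉ × ℤ₆ has parameters [[108, 8, 10]] (n = 108
data qubits, k = 8, distance EXACTLY 10). -/
@[route_item "route-Ventures-BB108DistanceCertificate"]
def Target : Prop :=
  Summit.Ventures.QEC.BB.BB108_8_10_claim

-- `Target` holds: proved by `Summit.Ventures.QEC.Census.BB108.target108_proof` (its module imports this route file, so no `_holds` link can be stated here).

/-- item stmt-Ventures-19828 · crux · rank 2 · closed · proved by Summit.Ventures.QEC.Census.BB108.noZLogicalBelowTen108_proof (prover) · by operator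
why it might fail: false iff a Z-logical of weight ≤ 9 exists (printed d by MIP, uncertified); residual risk after two signed certificates = an index-convention slip between the checker's flat literal and `BB.bb108` (x = S_ℓ ⊗ I_m vs I ⊗ S).
sources: BravyiEtAl2024, arXiv:2308.07915, Vardy1997, KapshikarKundu2023
[crux] LOWER BOUND — every v with H^X v = 0 and v ∉ rowspace(H^Z) (a Z-type logical operator of
BB.bb108) has Hamming weight ≥ 10; equivalently no Z-logical of weight ≤ 9 exists. Discharged by a
kernel-replayed enumeration / UNSAT certificate (certA bz db2184d2897de525, certB LRAT
596bc5aa9a750488, or search-7's information-set certificate), via `CertCheck` soundness +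
`BB.Code.dZ_eq_of_flat`. [difficulty: M] -/
@[route_item "route-Ventures-BB108DistanceCertificate"]
def NoZLogicalBelowTen108 : Prop :=
  ∀ v : Literature.InformationTheory.QuantumCodes.BB.Mono 9 6 ⊕ Literature.InformationTheory.QuantumCodes.BB.Mono 9 6 → ZMod 2, Matrix.mulVec (Literature.InformationTheory.QuantumCodes.BB.bb108).css.HX v = 0 → v ∉ (Literature.InformationTheory.QuantumCodes.BB.bb108).css.rowSpZ → 10 ≤ hammingNorm v

-- `NoZLogicalBelowTen108` holds: proved by `Summit.Ventures.QEC.Census.BB108.noZLogicalBelowTen108_proof` (its module imports this route file, so no `_holds` link can be stated here).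

/-- item stmt-Ventures-19829 · crux · rank 3 · closed · proved by Summit.Ventures.QEC.Census.BB108.weightTenZLogical108_proof (prover) · by operator
why it might fail: false iff d ≥ 11 (every weight-10 kernel word of H^X is a Z-stabiliser); the listed witness could be mis-transcribed or secretly in rowspace(H^Z) — the non-membership proof is the delicate part in Lean.
sources: BravyiEtAl2024, arXiv:2308.07915
[crux] UPPER WITNESS — there is an explicit v with H^X v = 0, v ∉ rowspace(H^Z) and |v| = 10 (a
weight-10 Z-type logical operator); the certificates list one (certA `upper.Z.word`), non-membership
in rowspace(H^Z) is a rank / syndrome check decidable on the literal matrices. [difficulty: S] -/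
@[route_item "route-Ventures-BB108DistanceCertificate"]
def WeightTenZLogical108 : Prop :=
  ∃ v : Literature.InformationTheory.QuantumCodes.BB.Mono 9 6 ⊕ Literature.InformationTheory.QuantumCodes.BB.Mono 9 6 → ZMod 2, Matrix.mulVec (Literature.InformationTheory.QuantumCodes.BB.bb108).css.HX v = 0 ∧ v ∉ (Literature.InformationTheory.QuantumCodes.BB.bb108).css.rowSpZ ∧ hammingNorm v = 10

-- `WeightTenZLogical108` holds: proved by `Summit.Ventures.QEC.Census.BB108.weightTenZLogical108_proof` (its module imports this route file, so no `_holds` link can be stated here).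

/-- item stmt-Ventures-19830 · support · rank 9 · closed · proved by Summit.Ventures.QEC.Theorems.EightLogicalQubits108_proof (prover) · by operator
sources: BravyiEtAl2024, arXiv:2308.07915, CalderbankShor1996
[support] DIMENSION — k(BB.bb108) = 108 − rk H^X − rk H^Z = 8 (rk H^X = rk H^Z = 50 over 𝔽₂), by a
rank certificate (type-02's Census/RankCert.lean p462257) transported with `BB.Code.cssFlat_k`;
equivalently k = 2·dim(ker A ∩ ker B) (Lemma 1). [difficulty: provable-now] -/
@[route_item "route-Ventures-BB108DistanceCertificate"]
def EightLogicalQubits108 : Prop :=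
  (Literature.InformationTheory.QuantumCodes.BB.bb108).k = 8

-- `EightLogicalQubits108` holds: proved by `Summit.Ventures.QEC.Theorems.EightLogicalQubits108_proof` (its module imports this route file, so no `_holds` link can be stated here).

/-- item stmt-Ventures-19831 · assembly · rank 1 · closed · proved by Summit.Ventures.QEC.Theorems.bb108DistanceCertificate_assembly_proof (prover) · by operator
sources: BravyiEtAl2024
[assembly] NoZLogicalBelowTen108 → WeightTenZLogical108 → EightLogicalQubits108 → the [[108,8,10]]
claim. -/
@[route_item "route-Ventures-BB108DistanceCertificate"]
def Assembly : Prop :=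
  NoZLogicalBelowTen108 → WeightTenZLogical108 → EightLogicalQubits108 → Summit.Ventures.QEC.BB.BB108_8_10_claim

-- `Assembly` holds: proved by `Summit.Ventures.QEC.Theorems.bb108DistanceCertificate_assembly_proof` (its module imports this route file, so no `_holds` link can be stated here).

/-! D-0027 §2.1 — DECIDING THEOREM (planner-authored via `route open/edit --closes-file`; by operator:999:2379292 2026-08-26T23:35:05Z) — ARCHIVED: route closed (proved) 2026-08-27T01:36:33Z; kept so importers keep building:
its hypotheses are this route's items and its conclusion the registered leaf `Summit.Ventures.QEC.BB.BB108_8_10_claim` (rung Q2, D-0061) (glue_lint), and it elaborates with this file. -/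

/-- **Deciding theorem of route BB108DistanceCertificate** (Ventures/QEC rung Q2; D-0027 §2.1, D-0059/D-0061/D-0092:
closes_target = the registered CLAIM leaf `Summit.Ventures.QEC.BB.BB108_8_10_claim`, never a summit Statement).
Lower bound + explicit weight-d witness ⇒ d^Z(BB.bb108) = d (`CSSCode.dZ_eq_of_witness`); n by counting
(`numQubits_claims.2.2.1`); k (support item); then `hasParams_of_dZ` (Lemma 1 of Bravyi et al.: `d = d^Z`, tree theorem
`BB.Code.d_eq_dZ`). Routed THROUGH `Assembly` and `Target` so both decls are in the cone of `closes`; every binder load-bearing;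
fully qualified names, no `open`. -/
@[closes "route-Ventures-BB108DistanceCertificate"] theorem closes (hL : NoZLogicalBelowTen108) (hU : WeightTenZLogical108) (hK : EightLogicalQubits108) :
    Summit.Ventures.QEC.BB.BB108_8_10_claim := by
  have hA : Assembly := fun hL' hU' hK' => by
    obtain ⟨v, hv, hv', hwt⟩ := hU'
    exact Summit.Ventures.QEC.BB.hasParams_of_dZ Summit.Ventures.QEC.BB.numQubits_claims.2.2.1 hK'
      ((Literature.InformationTheory.QuantumCodes.BB.bb108).css.dZ_eq_of_witness hv hv' hwt hL')
  have hT : Target := hA hL hU hK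
  exact hT

end Summit.Ventures.QEC.Theses.BB108DistanceCertificate
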